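/-
COR-CM (cell pub-hodgecm2, stage 2 of the Hodge ladder) — Δ2 BRIDGE, AUDIT OF THE END CANDIDATE ✔ p374084 `D2Bridge/ClosedPrintedMuConj.lean`
(COORDINATOR RULING 01:35Z 2026-08-24), SEAM (a) «mixed pairing» AS A KERNEL FACT.  Seat prover-pub-hodgecm2-d2bridge-wb-4-g4-0 (wb-4, μᶜ-adapter ∕
conjugate-side (c)(d)-by-value lineage).  THEOREMS ONLY (kernel lane): no definition, no notation, no instance, no named fact, no `sorry`; nothing
landed is edited or restated (the four displayed rows below are p374084's #2 #4 #5 #6, byte-for-byte).  FRAMING: HC_CM is NOT proved; «Δ2 BRIDGE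
CLOSED» is NOT claimed; hLiu = READING r8; HELD — WORLD = C FINAL.  This file asserts nothing about Liu's objects; it derives a CONSEQUENCE of the
END's displayed hypotheses.
-/
import Summits.HodgeConjecture.CorCM.D2Bridge.AdapterMuConj
import Summits.HodgeConjecture.CorCM.D2Bridge.OmegaAtDeltaPrimeLine
import Summits.HodgeConjecture.CorCM.B01.Transposition.Item6UniformOmegaRep
import Summits.HodgeConjecture.CorCM.B01.Transposition.Item6HirrOfLemD1AsPrinted
import Summits.HodgeConjecture.HodgeCM.Model.LiuIndexCentralType_1
import Summits.HodgeConjecture.HodgeCM.Model.LiuIndexMuLiu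
import Summits.HodgeConjecture.HodgeCM.Model.LiuDictionaryPinEq
import Literature.NumberTheory.Automorphic.Liu2021.AppendixC.Prop413DataOfRestOne
import Literature.NumberTheory.Automorphic.Liu2021.Thm418Invariants
import HarnessLib

/-!
# Seam (a) of the END candidate p374084 in the kernel: rows #2 and #5 decompose ONE `Ω(μ₀) ⊗ ℂ` twice and force a cross-label isomorphism

The END `MuConjEnd.hc_cm_of_printed_citations_muConj` (✔ p374084) displays, among its nine hypotheses,

* #2 `hLiu` — [Liu2021, Thm. 4.18] AS PRINTED at the record rest `restOne …` of the face datum: character `μ₀ := muOfInvType ι₁ Φ`, Ω-side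
  `ΩOne ℭ (AlgHom.id) ι₁ μ₀ …` («ℚ ⊗ Hom(Alb X_K, A_{μ₀})» with the Hecke action `ℋ.rhoΩOne`), ω-side the DISPLAY-frame summands
  `ω_{[diag V.diagEntries]}(μ₀; ε, χ)` (labels `μ₀`, splitting `hsMu`, group map `V.adelicFinDiag`);
* #5 `hLiuC` — [Liu2021, Thm. 4.18] AS PRINTED at the RELABELLED rests `(muConj 𝕌ᵢ).rest 𝔱⟦ν⟧`, every line `i`, EVERY conjugate-symplectic weight-one
  `ν`; at `ν := μ₀` its Ω-side is THE SAME `ΩOne ℭ (AlgHom.id) ι₁ μ₀ …` with the same `ℋ.rhoΩOne` (`restOne` and `U.rest (restTailOne …)` have the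
  same Ω-side fields, `UniformOmega.restOne_eq_rest`), while its ω-side is `(muConj 𝕌ᵢ).omega μ₀ _ ε χ = 𝕌ᵢ.omega μ₀ᶜ _ ε χ`
  (`AdapterMuConj.muConj`, rfl): the δ′-frame summands at the CONJUGATE label `μ₀ᶜ`;
* #4 `hD1` ([Lem. D.1 (1)] per place at the record's local data) and #6 `h411` ([Def. 4.11] at the δ′ rests).

`exists_crossEquiv_of_rows`: from these four rows ALONE (+ tree theorems), at every (F, Φ ∋ ι₁, V, a₀, line i), some display-frame summand
`ω_{[V.diagEntries]}(μ₀; a)` is `𝔾(𝔸_F^∞)`-equivariantly isomorphic to some δ′-frame summand `𝕌ᵢ.ω(μ₀ᶜ; b)` of row #5's datum at `ν = μ₀`.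
Route: #2 and #5 give two equivariant decompositions `Φ₂`, `Φ₅` of the one space `ℂ ⊗_{M_{μ₀}} ΩOne(μ₀)`; the index of #2 is non-empty
(`Thm418Data.nonempty_admIndex`, [Def. 4.12] by weak approximation) and its summands are irreducible by #4 (own-htheta's row-9 junction
`hirr_of_lemD1AsPrinted_row9`), hence non-zero; #5's non-zero summands are irreducible by #6 (`restOfCharRep_eq_rest` ▸, read at `μ₀ᶜ`);
Schur (`DirectSumCross.exists_equiv_of_two_decompositions`, §0) does the rest.

READING (audit, not a verdict).  In nature an adèlic oscillator representation `ω(μ₀, ε, χ)` is NOT isomorphic to any `ω(μ₀ᶜ, ε′, χ′)`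
(`μ₀ ≠ μ₀ᶜ` in weight one; [Liu2021, App. D Lem. D.1 (3)] — the cross-`μ` separation the END itself displays as #8 `hμsep`, there only WITHIN the
family `𝕌ᵢ`); the two frames `V.diagEntries` (`HComp/HermSpaceDiagonalFrame`) and `frameD V` (`HodgeCM/Model/Junction/RationalFrame`) are two
coordinatisations of the one hermitian space, so the conclusion below is absurd in nature in EITHER orientation world — i.e. rows #2 and #5 cannot
both be true of Liu's objects (tgtbt-1 FLAG A, prove-7 HOME/INBOX l.13116 (2)).  The kernel does not derive `False`: the frame-transport ∕ cross-frame
separation lemma is not in the tree.  Nothing is asserted inhabited; HC_CM is NOT proved; «Δ2 BRIDGE CLOSED» is NOT claimed.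

## References
* [Liu2021] Y. Liu, *Fourier–Jacobi cycles and arithmetic relative trace formula*, Camb. J. Math. 9 (2021) = arXiv:2102.11518: Thm. 4.18
  (FJcycle.tex l. 2232–2245), Def. 4.11 (l. 2083–2097), Def. 4.12 (l. 2102–2111), Rem. 4.4 (ll. 1912–1933), App. D Lem. D.1 (1),(3) (l. 5226–5233).
* [Bump1997] D. Bump, *Automorphic Forms and Representations*, CUP 1997, §4.2 Prop. 4.2.4 (Schur's lemma) and corollaries.
-/

set_option autoImplicit false

noncomputable section

open scoped TensorProduct Matrix DirectSum

/-! ## §0  Two equivariant decompositions of one module force a cross isomorphism of summands (representation-theoretic generality) -/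

namespace Summit.HodgeConjecture.CorCM.D2Bridge.SeamA.DirectSumCross

universe uk uG uX uι uκ uW uW'

variable {k : Type uk} [Field k] {G : Type uG} [Group G]
variable {X : Type uX} [AddCommGroup X] [Module k X]
variable {ι : Type uι} {κ : Type uκ} {W : ι → Type uW} {W' : κ → Type uW'}
variable [∀ i, AddCommGroup (W i)] [∀ i, Module k (W i)] [∀ j, AddCommGroup (W' j)] [∀ j, Module k (W' j)]
variable {σ : ∀ i, Representation k G (W i)} {σ' : ∀ j, Representation k G (W' j)}
/-- The composite `W i₀ ↪ ⨁ W ≃ X ≃ ⨁ W′ ↠ W′ j` is an intertwiner `σ i₀ → σ′ j` whenever `Φ₁`, `Φ₂` intertwine a common action `ρX` on `X`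
with the componentwise actions (plumbing: existence of the bundled map with the displayed values). [folklore] -/
theorem exists_crossComponent [DecidableEq ι] (ρX : G → X →ₗ[k] X)
    (Φ₁ : X ≃ₗ[k] ⨁ i, W i) (hΦ₁ : ∀ (g : G) (x : X) (i : ι), Φ₁ (ρX g x) i = σ i g (Φ₁ x i))
    (Φ₂ : X ≃ₗ[k] ⨁ j, W' j) (hΦ₂ : ∀ (g : G) (x : X) (j : κ), Φ₂ (ρX g x) j = σ' j g (Φ₂ x j)) (i₀ : ι) (j : κ) :
    ∃ c : (σ i₀).IntertwiningMap (σ' j),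
      ∀ v, c v = Φ₂ (Φ₁.symm (DirectSum.of W i₀ v)) j := by
  -- the action on `X` carries `Φ₁⁻¹ (ι_{i₀} v)` to `Φ₁⁻¹ (ι_{i₀} (σ i₀ g v))`
  have key : ∀ (g : G) (v : W i₀), ρX g (Φ₁.symm (DirectSum.of W i₀ v)) = Φ₁.symm (DirectSum.of W i₀ (σ i₀ g v)) := by
    intro g v
    rw [LinearEquiv.eq_symm_apply]
    refine DFinsupp.ext fun i => ?_
    rw [hΦ₁, LinearEquiv.apply_symm_apply]
    by_cases hi : i = i₀
    · subst hi
      rw [DirectSum.of_eq_same, DirectSum.of_eq_same]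
    · rw [DirectSum.of_eq_of_ne _ _ _ hi, DirectSum.of_eq_of_ne _ _ _ hi, map_zero]
  refine ⟨LinearMap.intertwiningMap_of_isIntertwiningMap (σ i₀) (σ' j)
      (DirectSum.component k κ W' j ∘ₗ Φ₂.toLinearMap ∘ₗ Φ₁.symm.toLinearMap ∘ₗ DirectSum.lof k ι W i₀) fun g v => ?_, fun v => ?_⟩
  · show DirectSum.component k κ W' j (Φ₂ (Φ₁.symm (DirectSum.lof k ι W i₀ (σ i₀ g v)))) =
      σ' j g (DirectSum.component k κ W' j (Φ₂ (Φ₁.symm (DirectSum.lof k ι W i₀ v))))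
    rw [DirectSum.lof_eq_of, DirectSum.lof_eq_of, ← key, ← DirectSum.apply_eq_component, ← DirectSum.apply_eq_component, hΦ₂]
  · show DirectSum.component k κ W' j (Φ₂ (Φ₁.symm (DirectSum.lof k ι W i₀ v))) = _
    rw [DirectSum.lof_eq_of, ← DirectSum.apply_eq_component]

/-- Pointwise form of the intertwining identity of a bundled intertwiner (plumbing). [folklore] -/
theorem intertwiningMap_apply_rho {V₁ V₂ : Type*} [AddCommGroup V₁] [Module k V₁] [AddCommGroup V₂] [Module k V₂]
    {ρ₁ : Representation k G V₁} {ρ₂ : Representation k G V₂} (c : ρ₁.IntertwiningMap ρ₂) (g : G) (v : V₁) :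
    c (ρ₁ g v) = ρ₂ g (c v) := by
  have h := LinearMap.congr_fun (c.isIntertwining' g) v
  simpa using h

/-- **Two equivariant decompositions of one module force a bijective cross intertwiner.**  If `Φ₁ : X ≃ ⨁ W` and `Φ₂ : X ≃ ⨁ W′` both
intertwine the action `ρX` on `X` with the componentwise actions `σ`, `σ′`, the summand `W i₀` is non-zero with `σ i₀` irreducible, and every
non-zero `W′ j` carries an irreducible `σ′ j`, then for some `j` there is a BIJECTIVE intertwiner `σ i₀ → σ′ j` (Schur: a non-zero intertwiner
between irreducibles is bijective). [cite: Bump1997, §4.2 Proposition 4.2.4 and corollaries] -/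
theorem exists_bijective_of_two_decompositions (ρX : G → X →ₗ[k] X)
    (Φ₁ : X ≃ₗ[k] ⨁ i, W i) (hΦ₁ : ∀ (g : G) (x : X) (i : ι), Φ₁ (ρX g x) i = σ i g (Φ₁ x i))
    (Φ₂ : X ≃ₗ[k] ⨁ j, W' j) (hΦ₂ : ∀ (g : G) (x : X) (j : κ), Φ₂ (ρX g x) j = σ' j g (Φ₂ x j))
    (i₀ : ι) (hW : Nontrivial (W i₀)) (hirr : (σ i₀).IsIrreducible) (hirr' : ∀ j, Nontrivial (W' j) → (σ' j).IsIrreducible) :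
    ∃ (j : κ) (c : (σ i₀).IntertwiningMap (σ' j)), Function.Bijective c := by
  classical
  haveI := hW
  haveI := hirr
  obtain ⟨v, hv⟩ := exists_ne (0 : W i₀)
  -- the image of `ι_{i₀} v` in `⨁ W′` is non-zero, so some component is
  have hne : Φ₂ (Φ₁.symm (DirectSum.of W i₀ v)) ≠ 0 := by
    intro h0
    apply hv
    have h1 : Φ₁.symm (DirectSum.of W i₀ v) = 0 := by simpa using h0
    have h2 : DirectSum.of W i₀ v = 0 := by simpa using h1
    exact DirectSum.of_injective i₀ (h2.trans (map_zero _).symm)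
  obtain ⟨j, hj⟩ : ∃ j, Φ₂ (Φ₁.symm (DirectSum.of W i₀ v)) j ≠ 0 := by
    by_contra hall
    push Not at hall
    exact hne (DFinsupp.ext hall)
  obtain ⟨c, hc⟩ := exists_crossComponent ρX Φ₁ hΦ₁ Φ₂ hΦ₂ i₀ j
  have hcv : c v ≠ 0 := by rw [hc]; exact hj
  haveI : Nontrivial (W' j) := ⟨⟨c v, 0, hcv⟩⟩
  haveI := hirr' j inferInstance
  rcases Representation.IsIrreducible.bijective_or_eq_zero c with hbij | h0
  · exact ⟨j, c, hbij⟩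
  · exact absurd (by rw [h0]; rfl) hcv

/-- **Two equivariant decompositions of one module force a cross isomorphism of summands** (`Representation.Equiv` form).
[cite: Bump1997, §4.2 Proposition 4.2.4 and corollaries] -/
theorem exists_equiv_of_two_decompositions (ρX : G → X →ₗ[k] X)
    (Φ₁ : X ≃ₗ[k] ⨁ i, W i) (hΦ₁ : ∀ (g : G) (x : X) (i : ι), Φ₁ (ρX g x) i = σ i g (Φ₁ x i))
    (Φ₂ : X ≃ₗ[k] ⨁ j, W' j) (hΦ₂ : ∀ (g : G) (x : X) (j : κ), Φ₂ (ρX g x) j = σ' j g (Φ₂ x j))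
    (i₀ : ι) (hW : Nontrivial (W i₀)) (hirr : (σ i₀).IsIrreducible) (hirr' : ∀ j, Nontrivial (W' j) → (σ' j).IsIrreducible) :
    ∃ j, Nonempty ((σ i₀).Equiv (σ' j)) := by
  obtain ⟨j, c, hbij⟩ := exists_bijective_of_two_decompositions ρX Φ₁ hΦ₁ Φ₂ hΦ₂ i₀ hW hirr hirr'
  exact ⟨j, ⟨c.ofBijective hbij⟩⟩

/-- The same conclusion in the «explicit linear equivalence» currency of the cell's displayed separation legs (`hμsep`:
`∃ f : ω_s ≃ₗ ω_t, ∀ g v, f (ρ_s g v) = ρ_t g (f v)`). [cite: Bump1997, §4.2 Proposition 4.2.4 and corollaries] -/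
theorem exists_linearEquiv_of_two_decompositions (ρX : G → X →ₗ[k] X)
    (Φ₁ : X ≃ₗ[k] ⨁ i, W i) (hΦ₁ : ∀ (g : G) (x : X) (i : ι), Φ₁ (ρX g x) i = σ i g (Φ₁ x i))
    (Φ₂ : X ≃ₗ[k] ⨁ j, W' j) (hΦ₂ : ∀ (g : G) (x : X) (j : κ), Φ₂ (ρX g x) j = σ' j g (Φ₂ x j))
    (i₀ : ι) (hW : Nontrivial (W i₀)) (hirr : (σ i₀).IsIrreducible) (hirr' : ∀ j, Nontrivial (W' j) → (σ' j).IsIrreducible) :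
    ∃ (j : κ) (f : W i₀ ≃ₗ[k] W' j), ∀ (g : G) (v : W i₀), f (σ i₀ g v) = σ' j g (f v) := by
  obtain ⟨j, c, hbij⟩ := exists_bijective_of_two_decompositions ρX Φ₁ hΦ₁ Φ₂ hΦ₂ i₀ hW hirr hirr'
  exact ⟨j, LinearEquiv.ofBijective c.toLinearMap hbij, fun g v => intertwiningMap_apply_rho c g v⟩


end Summit.HodgeConjecture.CorCM.D2Bridge.SeamA.DirectSumCross

/-! ## §1  Two [Liu2021, Thm. 4.18] readings on ONE `Ω(μ) ⊗ ℂ` (App-C generality): a cross isomorphism of summands -/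

namespace Summit.HodgeConjecture.CorCM.D2Bridge.SeamA

open NumberField
open Literature.NumberTheory.Automorphic Literature.NumberTheory.Automorphic.Liu2021 Literature.NumberTheory.Automorphic.Liu2021.AppendixC
open Literature.NumberTheory.Automorphic.Liu2021.AppendixC.RestOne
open Literature.RepresentationTheory Literature.RepresentationTheory.Liu2021

section Generic

variable {F E : Type} [Field F] [NumberField F] [IsTotallyReal F] [Field E] [NumberField E] [Algebra F E]
  [IsTotallyComplex E] [Algebra.IsQuadraticExtension F E] [IsCMField E]
variable {P5 : PropC5Data F E} {isotropicAt : ℕ → Prop} {C : Sec42Data P5 isotropicAt}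
variable {L : Type} [Field L] [NumberField L] [IsGalois ℚ L] {φ : E →ₐ[ℚ] L} {ι : L →+* ℂ}
variable {μ : Literature.NumberTheory.Automorphic.IdeleClassGroup E →ₜ* Circle} {hμ : IdeleClassGroup.IsConjugateSymplectic E μ}
  {hw : IdeleClassGroup.HasWeight E μ 1} {Car : Def45.Carriers E μ}

set_option synthInstance.maxHeartbeats 400000 in
set_option maxHeartbeats 3200000 in
/-- **Two readings of [Liu2021, Thm. 4.18] on ONE Ω-side force a cross isomorphism of summands** (App-C generality).  Over an App-C datum `C`,
at ONE character `μ` with its one-object tail `(φ, ι, hμ, hw, Car, rhoΩ)` ([Liu2021] Def. 4.5 (2), Def. 4.16, Rem. 4.17 — `Ω(μ) = ΩOne C φ ι μ …` with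
its Hecke action `rhoΩ`), suppose Thm. 4.18 AS PRINTED holds at TWO rests with that same Ω-side: the one-object rest `restOne C φ ι … Eps epsOf Chi ω ρ rhoΩ`
with summands `ω ε χ` (`H2`), and the rest `U.rest (restTailOne φ ι … rhoΩ)` of a μ-UNIFORM family `U` with summands `U.omega μ _ ε χ` (`H5`).  If every
summand `ω ε χ` at an admissible index is irreducible (`hirr₂`) and every non-zero admissible `U.omega μ _ ε χ` is irreducible (`hirr₅`), then some `ρ a`
is `𝔾(𝔸_F^∞)`-equivariantly isomorphic to some `U.rho μ _ b`: the two printed isomorphisms `Φ₂`, `Φ₅` have the SAME domain `ℂ ⊗_{M_μ} Ω(μ)`, the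
index of `H2` is non-empty ([Def. 4.12] by weak approximation, `Thm418Data.nonempty_admIndex`, given one character `χ₀`), and Schur (§0) applies to
`Φ₅ ∘ Φ₂⁻¹`.  Bookkeeping over the printed statement; nothing of [Liu2021] is asserted.
[cite: Liu2021, Thm. 4.18 (FJcycle.tex l. 2232–2245); Def. 4.12 (l. 2102–2111); Def. 4.16 (l. 2219); Rem. 4.17 (l. 2226–2228)] [cite: Bump1997, §4.2 Proposition 4.2.4] -/
theorem exists_crossEquiv_of_thm418AsPrinted_restOne_of_rest (U : UniformOmega C)
    (Eps : Type) (epsOf : E → Eps) (Chi : Type) (ω : Eps → Chi → Type)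
    [∀ ε χ, AddCommGroup (ω ε χ)] [∀ ε χ, Module ℂ (ω ε χ)] (ρ : ∀ ε χ, Representation ℂ C.G (ω ε χ))
    (rhoΩ : Representation (fieldOfValues E μ) C.G (ΩOne C φ ι hμ hw Car)) (χ₀ : Chi)
    (H2 : Thm418AsPrinted (toThm418Data C (restOne C φ ι hμ hw Car Eps epsOf Chi ω ρ rhoΩ)))
    (H5 : Thm418AsPrinted (toThm418Data C (U.rest (restTailOne φ ι hμ hw Car rhoΩ))))
    (hirr₂ : ∀ a : (toThm418Data C (restOne C φ ι hμ hw Car Eps epsOf Chi ω ρ rhoΩ)).AdmIndex, (Thm418Data.rhoAt _ a).IsIrreducible)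
    (hirr₅ : ∀ b : (toThm418Data C (U.rest (restTailOne φ ι hμ hw Car rhoΩ))).AdmIndex,
      Nontrivial (Thm418Data.omegaAt _ b) → (Thm418Data.rhoAt _ b).IsIrreducible) :
    ∃ (a : (toThm418Data C (restOne C φ ι hμ hw Car Eps epsOf Chi ω ρ rhoΩ)).AdmIndex)
      (b : (toThm418Data C (U.rest (restTailOne φ ι hμ hw Car rhoΩ))).AdmIndex),
      Nonempty (Representation.Equiv (G := C.G) (Thm418Data.rhoAt _ a) (Thm418Data.rhoAt _ b)) := by
  classical
  obtain ⟨Φ₂, hΦ₂, -, -, -⟩ := H2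
  obtain ⟨Φ₅, hΦ₅, -, -, -⟩ := H5
  -- a non-empty index on the `restOne` side ([Def 4.12] by weak approximation; the character `χ₀`)
  obtain ⟨a⟩ := Thm418Data.nonempty_admIndex (D := toThm418Data C (restOne C φ ι hμ hw Car Eps epsOf Chi ω ρ rhoΩ)) χ₀
  have hnt₂ : Nontrivial (Thm418Data.omegaAt _ a) := by
    haveI := hirr₂ a
    exact Representation.IsIrreducible.nontrivial (Thm418Data.rhoAt _ a)
  -- Schur on `Φ₅ ∘ Φ₂⁻¹`: both decompose the one space `ℂ ⊗_{M_μ} ΩOne(μ)` equivariantly for `rhoΩ`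
  obtain ⟨b, hb⟩ := DirectSumCross.exists_equiv_of_two_decompositions (G := C.G)
    (fun g => ((Thm418Data.rhoΩ (toThm418Data C (restOne C φ ι hμ hw Car Eps epsOf Chi ω ρ rhoΩ)) g).baseChange ℂ))
    Φ₂ hΦ₂ Φ₅ hΦ₅ a hnt₂ (hirr₂ a) hirr₅
  exact ⟨a, b, hb⟩

/-- **[Def. 4.11] READING I1 at the relabelled rest** (generic, symbolic — so that the kernel never compares `U` with `muConj U` on instantiated
terms): if [Liu2021, Def. 4.11] AS PRINTED holds at the rest `U.rest t` of `U` at the CONJUGATE character `νᶜ`, then every non-zero summand of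
[Thm. 4.18]'s datum at the rest `(muConj U).rest tc` at `ν` is irreducible — the summand there IS `U.omega νᶜ _ ε χ` (`AdapterMuConj.muConj`, rfl).
[cite: Liu2021, Def. 4.11 (FJcycle.tex l. 2092–2096); Rem. 4.4 (ll. 1912–1933)] -/
theorem isIrreducible_rhoAt_muConj_rest_of_def411AsPrinted (U : UniformOmega C)
    {ν : Literature.NumberTheory.Automorphic.IdeleClassGroup E →ₜ* Circle} {hν : IdeleClassGroup.IsConjugateSymplectic E ν}
    (tc : RestTail C ν hν)
    {hν' : IdeleClassGroup.IsConjugateSymplectic E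
      (Literature.NumberTheory.Automorphic.IdeleClassGroup.galConj (IsCMField.complexConj E) ν)}
    (t : RestTail C (Literature.NumberTheory.Automorphic.IdeleClassGroup.galConj (IsCMField.complexConj E) ν) hν')
    (h411 : Def411AsPrinted (toThm418Data C (U.rest t)))
    (b : (toThm418Data C ((Summit.HodgeConjecture.CorCM.D2Bridge.AdapterMuConj.muConj U).rest tc)).AdmIndex)
    (hb : Nontrivial (Thm418Data.omegaAt _ b)) :
    (Thm418Data.rhoAt _ b).IsIrreducible := by
  haveI := hb
  exact isIrreducible_of_nontrivial (h411 b.1.1 b.1.2).1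

end Generic

/-! ## §2  The END candidate's rows #2 #4 #5 #6 force a cross-label isomorphism `ω_{[V.diagEntries]}(μ₀; a) ≅ 𝕌ᵢ.ω(μ₀ᶜ; b)` -/

open NumberField NumberField.InfinitePlace
open HodgeCM.Model HodgeCM.Model.LiuIndex HodgeCM.Model.TowerCarrier
open Summit.HodgeConjecture.CorCM.Model
open Literature.AlgebraicGeometry.Motives (CMType)
open Literature.AlgebraicGeometry.HodgeTheory Literature.NumberTheory.Automorphic.PicardCM
open Literature.AlgebraicGeometry.ShimuraVarieties.UnitaryCanonicalModel
open Literature.NumberTheory.ComplexMultiplication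
open Literature.NumberTheory.Automorphic.IdeleClassGroup (toHeckeCharacter isUnitary_toHeckeCharacter)
open Literature.NumberTheory.Automorphic.Liu2021.Def411WeilCarriers (lineOf locF Rep)
open Summit.HodgeConjecture.CorCM.Transposition.OmegaTransport (realUnit)
open HodgeCM.Model.ArchSideTerm (e₁)
open Literature.NumberTheory.GelbartRogawski1991 Literature.NumberTheory.GelbartRogawski1991.UnitaryDualPair
open Literature.NumberTheory.GelbartRogawski1991.UnitaryDualPair.LocalSplitting (localMu norm_localMu continuous_localMu localMu_toLocalRing_eq_one_iff)
open Summit.HodgeConjecture.CorCM.Transposition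

set_option synthInstance.maxHeartbeats 400000 in
set_option maxHeartbeats 12000000 in
/-- **SEAM (a) IN THE KERNEL.**  From p374084's displayed rows #2 `hLiu`, #4 `hD1`, #5 `hLiuC`, #6 `h411` (binder texts byte-for-byte) and tree
theorems only: at every Galois CM field `F` with `6 ≤ [F:ℚ]`, CM type `Φ ∋ ι₁`, face datum `V`, scalar `a₀` and index line `i`, with
`μ₀ := muOfInvType ι₁ Φ`, SOME summand of row #2's datum (the display frame `diag V.diagEntries`, label `μ₀`) is `𝔾(𝔸_F^∞)`-equivariantly
isomorphic to SOME summand of row #5's datum at `ν := μ₀` (the δ′ frame `diag (frameD V)`, label `μ₀ᶜ`: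
`(muConj 𝕌ᵢ).omega μ₀ _ ε χ = 𝕌ᵢ.omega μ₀ᶜ _ ε χ`, `AdapterMuConj.muConj_omega`, rfl).  = §1 at `H2 := hLiu …` (row #2 at `(⟨K F⟩, Φ, ι₁, ⟨V.Hm,…⟩)`),
`H5 := hLiuC … μ₀ …` (row #5 at `(i, ν := μ₀)`), `hirr₂ :=` own-htheta's row-9 junction `hirr_of_lemD1AsPrinted_row9` on row #4 (the END's own meeting
step), `hirr₅ :=` row #6 at `μ₀ᶜ` moved along `restOfCharRep_eq_rest` (the END's own `eR` seam), READING I1 `isIrreducible_of_nontrivial`.  READING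
(audit, not a verdict): in nature no adèlic oscillator representation `ω(μ₀, ·)` is isomorphic to an `ω(μ₀ᶜ, ·)` ([Liu2021] App. D Lem. D.1 (3) —
displayed by the END as #8 `hμsep` WITHIN `𝕌ᵢ` —, `μ₀ ≠ μ₀ᶜ` in weight one; the frames `V.diagEntries` and `frameD V` are two coordinatisations of one
hermitian space), so rows #2 and #5 are not simultaneously true of Liu's objects in either orientation world; the kernel lacks the cross-frame
separation ∕ transport lemma and stops at this positive consequence.  HC_CM is NOT proved; nothing is asserted inhabited.
[cite: Liu2021, Thm. 4.18 (FJcycle.tex l. 2232–2245); Def. 4.11 (l. 2083–2097); Def. 4.12 (l. 2102–2111); Rem. 4.4 (ll. 1912–1933); App. D Lem. D.1 (1),(3) (l. 5226–5233)]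
[cite: Bump1997, §4.2 Proposition 4.2.4] -/
theorem exists_crossEquiv_of_rows
    (h : exists_recordSystem)
    (hLiu : ∀ (F : CMField) [IsGalois ℚ F] (h6 : 6 ≤ Module.finrank ℚ F) (Φ : CMType F) (ι₁ : F →+* ℂ), ι₁ ∈ Φ.1 →
      ∀ V : HermSpace3 F ι₁, Thm418AsPrintedC (sec42DataOf h isoOf F ι₁ V Φ)
        (restOne (sec42DataOf h isoOf F ι₁ V Φ) (AlgHom.id ℚ F) ι₁ (isConjugateSymplectic_muOfInvType ι₁ Φ) (hasWeight_one_muOfInvType ι₁ Φ) (Def45.Carriers.ofPolDR (muOfInvType ι₁ Φ) (Def45.PolDR ι₁ (isConjugateSymplectic_muOfInvType ι₁ Φ) (Def45.RMuForm ι₁ (isConjugateSymplectic_muOfInvType ι₁ Φ))))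
            (Def411WeilCarriers.Eps ↥(maximalRealSubfield F) (imagUnitSq F)) (Def411WeilCarriers.epsOf ↥(maximalRealSubfield F) (imagUnitSq F) F (imagUnit F)) (Def411WeilCarriers.Chi ↥(maximalRealSubfield F) F (IsCMField.complexConj F))
            (Def411WeilCarriers.omega ↥(maximalRealSubfield F) F (IsCMField.complexConj F) 3 finProdFinEquiv (Matrix.diagonal V.diagEntries) (complexConj_imagUnit F) (imagUnit_ne_zero F) (imagUnit_mul_self F) (realDiagonal_isSymm F V.diagEntries V.complexConj_diagEntries) (isUnit_det_realDiagonal F V.diagEntries V.complexConj_diagEntries V.diagEntries_ne_zero) (realDiagonal_map F V.diagEntries V.complexConj_diagEntries).symm (OmegaMuSplitting.hsMu F ι₁ V Φ))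
            (Def411WeilCarriers.rho ↥(maximalRealSubfield F) F (IsCMField.complexConj F) 3 finProdFinEquiv (Matrix.diagonal V.diagEntries) (complexConj_imagUnit F) (imagUnit_ne_zero F) (imagUnit_mul_self F) (realDiagonal_isSymm F V.diagEntries V.complexConj_diagEntries) (isUnit_det_realDiagonal F V.diagEntries V.complexConj_diagEntries V.diagEntries_ne_zero) (realDiagonal_map F V.diagEntries V.complexConj_diagEntries).symm (OmegaMuSplitting.hsMu F ι₁ V Φ) V.adelicFinDiag.toMulEquiv.toMonoidHom) ((heckeTranslatesFamilyOf heckeTranslate_definedOver_holds h isoOf F ι₁ V Φ h6).rhoΩOne (AlgHom.id ℚ F) ι₁ (isConjugateSymplectic_muOfInvType ι₁ Φ) (hasWeight_one_muOfInvType ι₁ Φ) (Def45.Carriers.ofPolDR (muOfInvType ι₁ Φ) (Def45.PolDR ι₁ (isConjugateSymplectic_muOfInvType ι₁ Φ) (Def45.RMuForm ι₁ (isConjugateSymplectic_muOfInvType ι₁ Φ)))))))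
    (hD1 : ∀ (F : CMField) [IsGalois ℚ F], 6 ≤ Module.finrank ℚ F → ∀ (Φ : CMType F) (ι₁ : F →+* ℂ), ι₁ ∈ Φ.1 →
      ∀ (V : HermSpace3 F ι₁) (ε : Def411WeilCarriers.Eps ↥(maximalRealSubfield F) (imagUnitSq F))
        (χ : Def411WeilCarriers.Chi ↥(maximalRealSubfield F) F (IsCMField.complexConj F)) (v : IsDedekindDomain.HeightOneSpectrum (𝓞 ↥(maximalRealSubfield F))),
        LemD1_1AsPrinted
          (Def411WeilCarriers.localLemD1Data ↥(maximalRealSubfield F) F (IsCMField.complexConj F) 3 finProdFinEquiv (Matrix.diagonal V.diagEntries)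
            (complexConj_imagUnit F) (imagUnit_ne_zero F) (imagUnit_mul_self F) (realDiagonal_isSymm F V.diagEntries V.complexConj_diagEntries)
            (isUnit_det_realDiagonal F V.diagEntries V.complexConj_diagEntries V.diagEntries_ne_zero)
            (realDiagonal_map F V.diagEntries V.complexConj_diagEntries).symm (lineOf ↥(maximalRealSubfield F) (imagUnitSq F) ε)
            (OmegaMuSplitting.muLocalSplittings F ι₁ V Φ (lineOf ↥(maximalRealSubfield F) (imagUnitSq F) ε))
            (le_of_eq (Nat.mul_one 3).symm) (localMu F (OmegaMuSplitting.chiMu F ι₁ Φ))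
            (fun v x => norm_localMu F (OmegaMuSplitting.chiMu F ι₁ Φ) v (OmegaMuSplitting.chiMu_isUnitary F ι₁ Φ) x)
            (continuous_localMu F (OmegaMuSplitting.chiMu F ι₁ Φ))
            (fun v t => localMu_toLocalRing_eq_one_iff F (OmegaMuSplitting.chiMu F ι₁ Φ) v (OmegaMuSplitting.chiMu_isSplittingChar F ι₁ Φ) t)
            χ.1
            (Def411WeilCarriers.norm_chi_eq_one ↥(maximalRealSubfield F) F (IsCMField.complexConj F)
              (Algebra.IsQuadraticExtension.finrank_eq_two ↥(maximalRealSubfield F) F)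
              (UnitaryGroup.algEquiv_ne_one_of_apply_eq_neg ↥(maximalRealSubfield F) F (IsCMField.complexConj F) (complexConj_imagUnit F)
                (imagUnit_ne_zero F)) χ)
            χ.2.1 v))
    (hLiuC : ∀ (F : HodgeCM.CMField) [IsGalois ℚ F] (h6 : 6 ≤ Module.finrank ℚ F) {ι₁ : F →+* ℂ} (V : HodgeCM.HermSpace3 F ι₁) (a₀ : RealScalar F)
      (Φ : CMType F) (hΦ : ι₁ ∈ Φ.1) (i : (I V (repAt a₀) (muLiu ι₁ GramClass.rep))) (ν : Literature.NumberTheory.Automorphic.IdeleClassGroup (F : Type) →ₜ* Circle)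
      (hν : IdeleClassGroup.IsConjugateSymplectic (F : Type) ν) (hw : IdeleClassGroup.HasWeight (F : Type) ν 1),
      Thm418AsPrinted (toThm418Data _ ((Summit.HodgeConjecture.CorCM.D2Bridge.AdapterMuConj.muConj (uniformOmegaRep h ⟨HodgeCM.CMField.K F⟩ ι₁ ⟨HodgeCM.HermSpace3.Hm V, HodgeCM.HermSpace3.isHermitian V, HodgeCM.HermSpace3.signature_ι₁ V, HodgeCM.HermSpace3.posDef_of_ne V⟩ Φ e₁ (frameD V) (frameD_real V) (frameD_ne V) (ιVE V) (2 * imagUnit (HodgeCM.CMField.K F))⁻¹ (fun _ _ => (Rep.update ↥(maximalRealSubfield (HodgeCM.CMField.K F)) (imagUnitSq (HodgeCM.CMField.K F)) (Rep.ofLineOf ↥(maximalRealSubfield (HodgeCM.CMField.K F)) (imagUnitSq (HodgeCM.CMField.K F))) (locF ↥(maximalRealSubfield (HodgeCM.CMField.K F)) (imagUnitSq (HodgeCM.CMField.K F)) (realUnit ⟨HodgeCM.CMField.K F⟩ (repAt a₀ (Sigma.fst i)).1 (repAt a₀ (Sigma.fst i)).2.1 (repAt a₀ (Sigma.fst i)).2.2))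 (realUnit ⟨HodgeCM.CMField.K F⟩ (repAt a₀ (Sigma.fst i)).1 (repAt a₀ (Sigma.fst i)).2.1 (repAt a₀ (Sigma.fst i)).2.2) rfl)))).rest (restTailOne (AlgHom.id ℚ _) ι₁ hν hw (Def45.Carriers.ofPolDR ν (Def45.PolDR ι₁ hν (Def45.RMuForm ι₁ hν))) ((heckeTranslatesFamilyOf heckeTranslate_definedOver_holds h isoOf ⟨HodgeCM.CMField.K F⟩ ι₁ ⟨HodgeCM.HermSpace3.Hm V, HodgeCM.HermSpace3.isHermitian V, HodgeCM.HermSpace3.signature_ι₁ V, HodgeCM.HermSpace3.posDef_of_ne V⟩ Φ h6).rhoΩOne (AlgHom.id ℚ _) ι₁ hν hw (Def45.Carriers.ofPolDR ν (Def45.PolDR ι₁ hν (Def45.RMuForm ι₁ hν))))))))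
    (h411 : ∀ (F : HodgeCM.CMField) [IsGalois ℚ F] (h6 : 6 ≤ Module.finrank ℚ F) {ι₁ : F →+* ℂ} (V : HodgeCM.HermSpace3 F ι₁) (a₀ : RealScalar F)
      (Φ : CMType F) (hΦ : ι₁ ∈ Φ.1) (i : (I V (repAt a₀) (muLiu ι₁ GramClass.rep))) (μ : Literature.NumberTheory.Automorphic.IdeleClassGroup (F : Type) →ₜ* Circle)
      (hμ : IdeleClassGroup.IsConjugateSymplectic (F : Type) μ) (hw : IdeleClassGroup.HasWeight (F : Type) μ 1),
      Def411AsPrinted (toThm418Data _ (restOfCharDeltaPrime h ⟨HodgeCM.CMField.K F⟩ h6 ι₁ ⟨HodgeCM.HermSpace3.Hm V, HodgeCM.HermSpace3.isHermitian V, HodgeCM.HermSpace3.signature_ι₁ V, HodgeCM.HermSpace3.posDef_of_ne V⟩ Φ e₁ (frameD V) (frameD_real V) (frameD_ne V) (ιVE V) (Rep.update ↥(maximalRealSubfield (HodgeCM.CMField.K F)) (imagUnitSq (HodgeCM.CMField.K F)) (Rep.ofLineOf ↥(maximalRealSubfield (HodgeCM.CMField.K F)) (imagUnitSq (HodgeCM.CMField.K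 F))) (locF ↥(maximalRealSubfield (HodgeCM.CMField.K F)) (imagUnitSq (HodgeCM.CMField.K F)) (realUnit ⟨HodgeCM.CMField.K F⟩ (repAt a₀ (Sigma.fst i)).1 (repAt a₀ (Sigma.fst i)).2.1 (repAt a₀ (Sigma.fst i)).2.2)) (realUnit ⟨HodgeCM.CMField.K F⟩ (repAt a₀ (Sigma.fst i)).1 (repAt a₀ (Sigma.fst i)).2.1 (repAt a₀ (Sigma.fst i)).2.2) rfl) μ hμ hw)))
    (F : HodgeCM.CMField) [IsGalois ℚ F] (h6 : 6 ≤ Module.finrank ℚ F) {ι₁ : F →+* ℂ} (V : HodgeCM.HermSpace3 F ι₁) (a₀ : RealScalar F)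
    (Φ : CMType F) (hΦ : ι₁ ∈ Φ.1) (i : (I V (repAt a₀) (muLiu ι₁ GramClass.rep))) :
    ∃ (a : (toThm418Data (sec42DataOf h isoOf ⟨HodgeCM.CMField.K F⟩ ι₁ ⟨HodgeCM.HermSpace3.Hm V, HodgeCM.HermSpace3.isHermitian V, HodgeCM.HermSpace3.signature_ι₁ V, HodgeCM.HermSpace3.posDef_of_ne V⟩ Φ) (restOne (sec42DataOf h isoOf ⟨HodgeCM.CMField.K F⟩ ι₁ ⟨HodgeCM.HermSpace3.Hm V, HodgeCM.HermSpace3.isHermitian V, HodgeCM.HermSpace3.signature_ι₁ V, HodgeCM.HermSpace3.posDef_of_ne V⟩ Φ) (AlgHom.id ℚ (HodgeCM.CMField.K F)) ι₁ (isConjugateSymplectic_muOfInvType (F := ⟨HodgeCM.CMField.K F⟩) ι₁ Φ) (hasWeight_one_muOfInvType (F := ⟨HodgeCM.CMField.K F⟩) ι₁ Φ) (Def45.Carriers.ofPolDR (muOfInvType (F := ⟨HodgeCM.CMField.K F⟩) ι₁ Φ) (Def45.PolDR ι₁ (isConjugateSymplectic_muOfInvType (F := ⟨HodgeCM.CMField.K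 F⟩) ι₁ Φ) (Def45.RMuForm ι₁ (isConjugateSymplectic_muOfInvType (F := ⟨HodgeCM.CMField.K F⟩) ι₁ Φ)))) (Def411WeilCarriers.Eps ↥(maximalRealSubfield F) (imagUnitSq F)) (Def411WeilCarriers.epsOf ↥(maximalRealSubfield F) (imagUnitSq F) F (imagUnit F)) (Def411WeilCarriers.Chi ↥(maximalRealSubfield F) F (IsCMField.complexConj F)) (Def411WeilCarriers.omega ↥(maximalRealSubfield F) F (IsCMField.complexConj F) 3 finProdFinEquiv (Matrix.diagonal (⟨HodgeCM.HermSpace3.Hm V, HodgeCM.HermSpace3.isHermitian V, HodgeCM.HermSpace3.signature_ι₁ V, HodgeCM.HermSpace3.posDef_of_ne V⟩ : HermSpace3 ⟨HodgeCM.CMField.K F⟩ ι₁).diagEntries) (complexConj_imagUnit F) (imagUnit_ne_zero F) (imagUnit_mul_self F) (realDiagonal_isSymm F (⟨HodgeCM.HermSpace3.Hm V, HodgeCM.HermSpace3.isHermitian V, HodgeCM.HermSpace3.signature_ι₁ V, HodgeCM.HermSpace3.posDef_of_ne V⟩ : HermSpace3 ⟨HodgeCM.CMField.K F⟩ ι₁).diagEntries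 (⟨HodgeCM.HermSpace3.Hm V, HodgeCM.HermSpace3.isHermitian V, HodgeCM.HermSpace3.signature_ι₁ V, HodgeCM.HermSpace3.posDef_of_ne V⟩ : HermSpace3 ⟨HodgeCM.CMField.K F⟩ ι₁).complexConj_diagEntries) (isUnit_det_realDiagonal F (⟨HodgeCM.HermSpace3.Hm V, HodgeCM.HermSpace3.isHermitian V, HodgeCM.HermSpace3.signature_ι₁ V, HodgeCM.HermSpace3.posDef_of_ne V⟩ : HermSpace3 ⟨HodgeCM.CMField.K F⟩ ι₁).diagEntries (⟨HodgeCM.HermSpace3.Hm V, HodgeCM.HermSpace3.isHermitian V, HodgeCM.HermSpace3.signature_ι₁ V, HodgeCM.HermSpace3.posDef_of_ne V⟩ : HermSpace3 ⟨HodgeCM.CMField.K F⟩ ι₁).complexConj_diagEntries (⟨HodgeCM.HermSpace3.Hm V, HodgeCM.HermSpace3.isHermitian V, HodgeCM.HermSpace3.signature_ι₁ V, HodgeCM.HermSpace3.posDef_of_ne V⟩ : HermSpace3 ⟨HodgeCM.CMField.K F⟩ ι₁).diagEntries_ne_zero) (realDiagonal_map F (⟨HodgeCM.HermSpace3.Hm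 V, HodgeCM.HermSpace3.isHermitian V, HodgeCM.HermSpace3.signature_ι₁ V, HodgeCM.HermSpace3.posDef_of_ne V⟩ : HermSpace3 ⟨HodgeCM.CMField.K F⟩ ι₁).diagEntries (⟨HodgeCM.HermSpace3.Hm V, HodgeCM.HermSpace3.isHermitian V, HodgeCM.HermSpace3.signature_ι₁ V, HodgeCM.HermSpace3.posDef_of_ne V⟩ : HermSpace3 ⟨HodgeCM.CMField.K F⟩ ι₁).complexConj_diagEntries).symm (OmegaMuSplitting.hsMu ⟨HodgeCM.CMField.K F⟩ ι₁ ⟨HodgeCM.HermSpace3.Hm V, HodgeCM.HermSpace3.isHermitian V, HodgeCM.HermSpace3.signature_ι₁ V, HodgeCM.HermSpace3.posDef_of_ne V⟩ Φ)) (Def411WeilCarriers.rho ↥(maximalRealSubfield F) F (IsCMField.complexConj F) 3 finProdFinEquiv (Matrix.diagonal (⟨HodgeCM.HermSpace3.Hm V, HodgeCM.HermSpace3.isHermitian V, HodgeCM.HermSpace3.signature_ι₁ V, HodgeCM.HermSpace3.posDef_of_ne V⟩ : HermSpace3 ⟨HodgeCM.CMField.K F⟩ ι₁).diagEntries) (complexConj_imagUnit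 F) (imagUnit_ne_zero F) (imagUnit_mul_self F) (realDiagonal_isSymm F (⟨HodgeCM.HermSpace3.Hm V, HodgeCM.HermSpace3.isHermitian V, HodgeCM.HermSpace3.signature_ι₁ V, HodgeCM.HermSpace3.posDef_of_ne V⟩ : HermSpace3 ⟨HodgeCM.CMField.K F⟩ ι₁).diagEntries (⟨HodgeCM.HermSpace3.Hm V, HodgeCM.HermSpace3.isHermitian V, HodgeCM.HermSpace3.signature_ι₁ V, HodgeCM.HermSpace3.posDef_of_ne V⟩ : HermSpace3 ⟨HodgeCM.CMField.K F⟩ ι₁).complexConj_diagEntries) (isUnit_det_realDiagonal F (⟨HodgeCM.HermSpace3.Hm V, HodgeCM.HermSpace3.isHermitian V, HodgeCM.HermSpace3.signature_ι₁ V, HodgeCM.HermSpace3.posDef_of_ne V⟩ : HermSpace3 ⟨HodgeCM.CMField.K F⟩ ι₁).diagEntries (⟨HodgeCM.HermSpace3.Hm V, HodgeCM.HermSpace3.isHermitian V, HodgeCM.HermSpace3.signature_ι₁ V, HodgeCM.HermSpace3.posDef_of_ne V⟩ : HermSpace3 ⟨HodgeCM.CMField.K F⟩ ι₁).complexConj_diagEntries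 (⟨HodgeCM.HermSpace3.Hm V, HodgeCM.HermSpace3.isHermitian V, HodgeCM.HermSpace3.signature_ι₁ V, HodgeCM.HermSpace3.posDef_of_ne V⟩ : HermSpace3 ⟨HodgeCM.CMField.K F⟩ ι₁).diagEntries_ne_zero) (realDiagonal_map F (⟨HodgeCM.HermSpace3.Hm V, HodgeCM.HermSpace3.isHermitian V, HodgeCM.HermSpace3.signature_ι₁ V, HodgeCM.HermSpace3.posDef_of_ne V⟩ : HermSpace3 ⟨HodgeCM.CMField.K F⟩ ι₁).diagEntries (⟨HodgeCM.HermSpace3.Hm V, HodgeCM.HermSpace3.isHermitian V, HodgeCM.HermSpace3.signature_ι₁ V, HodgeCM.HermSpace3.posDef_of_ne V⟩ : HermSpace3 ⟨HodgeCM.CMField.K F⟩ ι₁).complexConj_diagEntries).symm (OmegaMuSplitting.hsMu ⟨HodgeCM.CMField.K F⟩ ι₁ ⟨HodgeCM.HermSpace3.Hm V, HodgeCM.HermSpace3.isHermitian V, HodgeCM.HermSpace3.signature_ι₁ V, HodgeCM.HermSpace3.posDef_of_ne V⟩ Φ) (⟨HodgeCM.HermSpace3.Hm V, HodgeCM.HermSpace3.isHermitian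 V, HodgeCM.HermSpace3.signature_ι₁ V, HodgeCM.HermSpace3.posDef_of_ne V⟩ : HermSpace3 ⟨HodgeCM.CMField.K F⟩ ι₁).adelicFinDiag.toMulEquiv.toMonoidHom) ((heckeTranslatesFamilyOf heckeTranslate_definedOver_holds h isoOf ⟨HodgeCM.CMField.K F⟩ ι₁ ⟨HodgeCM.HermSpace3.Hm V, HodgeCM.HermSpace3.isHermitian V, HodgeCM.HermSpace3.signature_ι₁ V, HodgeCM.HermSpace3.posDef_of_ne V⟩ Φ h6).rhoΩOne (AlgHom.id ℚ (HodgeCM.CMField.K F)) ι₁ (isConjugateSymplectic_muOfInvType (F := ⟨HodgeCM.CMField.K F⟩) ι₁ Φ) (hasWeight_one_muOfInvType (F := ⟨HodgeCM.CMField.K F⟩) ι₁ Φ) (Def45.Carriers.ofPolDR (muOfInvType (F := ⟨HodgeCM.CMField.K F⟩) ι₁ Φ) (Def45.PolDR ι₁ (isConjugateSymplectic_muOfInvType (F := ⟨HodgeCM.CMField.K F⟩) ι₁ Φ) (Def45.RMuForm ι₁ (isConjugateSymplectic_muOfInvType (F := ⟨HodgeCM.CMField.K F⟩) ι₁ Φ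))))))).AdmIndex)
      (b : (toThm418Data (sec42DataOf h isoOf ⟨HodgeCM.CMField.K F⟩ ι₁ ⟨HodgeCM.HermSpace3.Hm V, HodgeCM.HermSpace3.isHermitian V, HodgeCM.HermSpace3.signature_ι₁ V, HodgeCM.HermSpace3.posDef_of_ne V⟩ Φ) ((Summit.HodgeConjecture.CorCM.D2Bridge.AdapterMuConj.muConj (uniformOmegaRep h ⟨HodgeCM.CMField.K F⟩ ι₁ ⟨HodgeCM.HermSpace3.Hm V, HodgeCM.HermSpace3.isHermitian V, HodgeCM.HermSpace3.signature_ι₁ V, HodgeCM.HermSpace3.posDef_of_ne V⟩ Φ e₁ (frameD V) (frameD_real V) (frameD_ne V) (ιVE V) (2 * imagUnit (HodgeCM.CMField.K F))⁻¹ (fun _ _ => (Rep.update ↥(maximalRealSubfield (HodgeCM.CMField.K F)) (imagUnitSq (HodgeCM.CMField.K F)) (Rep.ofLineOf ↥(maximalRealSubfield (HodgeCM.CMField.K F)) (imagUnitSq (HodgeCM.CMField.K F))) (locF ↥(maximalRealSubfield (HodgeCM.CMField.K F)) (imagUnitSq (HodgeCM.CMField.K F)) (realUnit ⟨HodgeCM.CMField.K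 F⟩ (repAt a₀ (Sigma.fst i)).1 (repAt a₀ (Sigma.fst i)).2.1 (repAt a₀ (Sigma.fst i)).2.2)) (realUnit ⟨HodgeCM.CMField.K F⟩ (repAt a₀ (Sigma.fst i)).1 (repAt a₀ (Sigma.fst i)).2.1 (repAt a₀ (Sigma.fst i)).2.2) rfl)))).rest (restTailOne (AlgHom.id ℚ (HodgeCM.CMField.K F)) ι₁ (isConjugateSymplectic_muOfInvType (F := ⟨HodgeCM.CMField.K F⟩) ι₁ Φ) (hasWeight_one_muOfInvType (F := ⟨HodgeCM.CMField.K F⟩) ι₁ Φ) (Def45.Carriers.ofPolDR (muOfInvType (F := ⟨HodgeCM.CMField.K F⟩) ι₁ Φ) (Def45.PolDR ι₁ (isConjugateSymplectic_muOfInvType (F := ⟨HodgeCM.CMField.K F⟩) ι₁ Φ) (Def45.RMuForm ι₁ (isConjugateSymplectic_muOfInvType (F := ⟨HodgeCM.CMField.K F⟩) ι₁ Φ)))) ((heckeTranslatesFamilyOf heckeTranslate_definedOver_holds h isoOf ⟨HodgeCM.CMField.K F⟩ ι₁ ⟨HodgeCM.HermSpace3.Hm V, HodgeCM.HermSpace3.isHermitian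 V, HodgeCM.HermSpace3.signature_ι₁ V, HodgeCM.HermSpace3.posDef_of_ne V⟩ Φ h6).rhoΩOne (AlgHom.id ℚ (HodgeCM.CMField.K F)) ι₁ (isConjugateSymplectic_muOfInvType (F := ⟨HodgeCM.CMField.K F⟩) ι₁ Φ) (hasWeight_one_muOfInvType (F := ⟨HodgeCM.CMField.K F⟩) ι₁ Φ) (Def45.Carriers.ofPolDR (muOfInvType (F := ⟨HodgeCM.CMField.K F⟩) ι₁ Φ) (Def45.PolDR ι₁ (isConjugateSymplectic_muOfInvType (F := ⟨HodgeCM.CMField.K F⟩) ι₁ Φ) (Def45.RMuForm ι₁ (isConjugateSymplectic_muOfInvType (F := ⟨HodgeCM.CMField.K F⟩) ι₁ Φ)))))))).AdmIndex),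
      Nonempty (Representation.Equiv (G := (sec42DataOf h isoOf ⟨HodgeCM.CMField.K F⟩ ι₁ ⟨HodgeCM.HermSpace3.Hm V, HodgeCM.HermSpace3.isHermitian V, HodgeCM.HermSpace3.signature_ι₁ V, HodgeCM.HermSpace3.posDef_of_ne V⟩ Φ).G) (Thm418Data.rhoAt _ a) (Thm418Data.rhoAt _ b)) := by
  haveI : NeZero (3 * 1) := ⟨by decide⟩
  -- row #6 at `μ₀ᶜ`, moved to `𝕌ᵢ.rest` along `restOfCharRep_eq_rest` (the END's own `eR` seam)
  have h411U : Def411AsPrinted (toThm418Data (sec42DataOf h isoOf ⟨HodgeCM.CMField.K F⟩ ι₁ ⟨HodgeCM.HermSpace3.Hm V, HodgeCM.HermSpace3.isHermitian V, HodgeCM.HermSpace3.signature_ι₁ V, HodgeCM.HermSpace3.posDef_of_ne V⟩ Φ) ((uniformOmegaRep h ⟨HodgeCM.CMField.K F⟩ ι₁ ⟨HodgeCM.HermSpace3.Hm V, HodgeCM.HermSpace3.isHermitian V, HodgeCM.HermSpace3.signature_ι₁ V, HodgeCM.HermSpace3.posDef_of_ne V⟩ Φ e₁ (frameD V) (frameD_real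 V) (frameD_ne V) (ιVE V) (2 * imagUnit (HodgeCM.CMField.K F))⁻¹ (fun _ _ => (Rep.update ↥(maximalRealSubfield (HodgeCM.CMField.K F)) (imagUnitSq (HodgeCM.CMField.K F)) (Rep.ofLineOf ↥(maximalRealSubfield (HodgeCM.CMField.K F)) (imagUnitSq (HodgeCM.CMField.K F))) (locF ↥(maximalRealSubfield (HodgeCM.CMField.K F)) (imagUnitSq (HodgeCM.CMField.K F)) (realUnit ⟨HodgeCM.CMField.K F⟩ (repAt a₀ (Sigma.fst i)).1 (repAt a₀ (Sigma.fst i)).2.1 (repAt a₀ (Sigma.fst i)).2.2)) (realUnit ⟨HodgeCM.CMField.K F⟩ (repAt a₀ (Sigma.fst i)).1 (repAt a₀ (Sigma.fst i)).2.1 (repAt a₀ (Sigma.fst i)).2.2) rfl))).rest (restTailOne (AlgHom.id ℚ (HodgeCM.CMField.K F)) ι₁ (isConjugateSymplectic_muOfInvType (F := ⟨HodgeCM.CMField.K F⟩) ι₁ Φ).galConj (hasWeight_one_muOfInvType (F := ⟨HodgeCM.CMField.K F⟩) ι₁ Φ).galConj_complexConj (Def45.Carriers.ofPolDR (Literature.NumberTheory.Automorphic.IdeleClassGroup.galConj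 (IsCMField.complexConj (HodgeCM.CMField.K F)) (muOfInvType (F := ⟨HodgeCM.CMField.K F⟩) ι₁ Φ)) (Def45.PolDR ι₁ (isConjugateSymplectic_muOfInvType (F := ⟨HodgeCM.CMField.K F⟩) ι₁ Φ).galConj (Def45.RMuForm ι₁ (isConjugateSymplectic_muOfInvType (F := ⟨HodgeCM.CMField.K F⟩) ι₁ Φ).galConj))) ((heckeTranslatesFamilyOf heckeTranslate_definedOver_holds h isoOf ⟨HodgeCM.CMField.K F⟩ ι₁ ⟨HodgeCM.HermSpace3.Hm V, HodgeCM.HermSpace3.isHermitian V, HodgeCM.HermSpace3.signature_ι₁ V, HodgeCM.HermSpace3.posDef_of_ne V⟩ Φ h6).rhoΩOne (AlgHom.id ℚ (HodgeCM.CMField.K F)) ι₁ (isConjugateSymplectic_muOfInvType (F := ⟨HodgeCM.CMField.K F⟩) ι₁ Φ).galConj (hasWeight_one_muOfInvType (F := ⟨HodgeCM.CMField.K F⟩) ι₁ Φ).galConj_complexConj (Def45.Carriers.ofPolDR (Literature.NumberTheory.Automorphic.IdeleClassGroup.galConj (IsCMField.complexConj (HodgeCM.CMField.K F)) (muOfInvType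 (F := ⟨HodgeCM.CMField.K F⟩) ι₁ Φ)) (Def45.PolDR ι₁ (isConjugateSymplectic_muOfInvType (F := ⟨HodgeCM.CMField.K F⟩) ι₁ Φ).galConj (Def45.RMuForm ι₁ (isConjugateSymplectic_muOfInvType (F := ⟨HodgeCM.CMField.K F⟩) ι₁ Φ).galConj))))))) :=
    (restOfCharRep_eq_rest h ⟨HodgeCM.CMField.K F⟩ ι₁ ⟨HodgeCM.HermSpace3.Hm V, HodgeCM.HermSpace3.isHermitian V, HodgeCM.HermSpace3.signature_ι₁ V, HodgeCM.HermSpace3.posDef_of_ne V⟩ Φ e₁ (frameD V) (frameD_real V) (frameD_ne V) (ιVE V) (2 * imagUnit (HodgeCM.CMField.K F))⁻¹ (fun _ _ => (Rep.update ↥(maximalRealSubfield (HodgeCM.CMField.K F)) (imagUnitSq (HodgeCM.CMField.K F)) (Rep.ofLineOf ↥(maximalRealSubfield (HodgeCM.CMField.K F)) (imagUnitSq (HodgeCM.CMField.K F))) (locF ↥(maximalRealSubfield (HodgeCM.CMField.K F)) (imagUnitSq (HodgeCM.CMField.K F)) (realUnit ⟨HodgeCM.CMField.K F⟩ (repAt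 a₀ (Sigma.fst i)).1 (repAt a₀ (Sigma.fst i)).2.1 (repAt a₀ (Sigma.fst i)).2.2)) (realUnit ⟨HodgeCM.CMField.K F⟩ (repAt a₀ (Sigma.fst i)).1 (repAt a₀ (Sigma.fst i)).2.1 (repAt a₀ (Sigma.fst i)).2.2) rfl)) h6 (Literature.NumberTheory.Automorphic.IdeleClassGroup.galConj (IsCMField.complexConj (HodgeCM.CMField.K F)) (muOfInvType (F := ⟨HodgeCM.CMField.K F⟩) ι₁ Φ)) (isConjugateSymplectic_muOfInvType (F := ⟨HodgeCM.CMField.K F⟩) ι₁ Φ).galConj (hasWeight_one_muOfInvType (F := ⟨HodgeCM.CMField.K F⟩) ι₁ Φ).galConj_complexConj) ▸ h411 F h6 V a₀ Φ hΦ i (Literature.NumberTheory.Automorphic.IdeleClassGroup.galConj (IsCMField.complexConj (HodgeCM.CMField.K F)) (muOfInvType (F := ⟨HodgeCM.CMField.K F⟩) ι₁ Φ)) (isConjugateSymplectic_muOfInvType (F := ⟨HodgeCM.CMField.K F⟩) ι₁ Φ).galConj (hasWeight_one_muOfInvType (F := ⟨HodgeCM.CMField.K F⟩) ι₁ Φ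).galConj_complexConj
  have key := exists_crossEquiv_of_thm418AsPrinted_restOne_of_rest (Summit.HodgeConjecture.CorCM.D2Bridge.AdapterMuConj.muConj (uniformOmegaRep h ⟨HodgeCM.CMField.K F⟩ ι₁ ⟨HodgeCM.HermSpace3.Hm V, HodgeCM.HermSpace3.isHermitian V, HodgeCM.HermSpace3.signature_ι₁ V, HodgeCM.HermSpace3.posDef_of_ne V⟩ Φ e₁ (frameD V) (frameD_real V) (frameD_ne V) (ιVE V) (2 * imagUnit (HodgeCM.CMField.K F))⁻¹ (fun _ _ => (Rep.update ↥(maximalRealSubfield (HodgeCM.CMField.K F)) (imagUnitSq (HodgeCM.CMField.K F)) (Rep.ofLineOf ↥(maximalRealSubfield (HodgeCM.CMField.K F)) (imagUnitSq (HodgeCM.CMField.K F))) (locF ↥(maximalRealSubfield (HodgeCM.CMField.K F)) (imagUnitSq (HodgeCM.CMField.K F)) (realUnit ⟨HodgeCM.CMField.K F⟩ (repAt a₀ (Sigma.fst i)).1 (repAt a₀ (Sigma.fst i)).2.1 (repAt a₀ (Sigma.fst i)).2.2)) (realUnit ⟨HodgeCM.CMField.K F⟩ (repAt a₀ (Sigma.fst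 i)).1 (repAt a₀ (Sigma.fst i)).2.1 (repAt a₀ (Sigma.fst i)).2.2) rfl))))
    (Def411WeilCarriers.Eps ↥(maximalRealSubfield F) (imagUnitSq F)) (Def411WeilCarriers.epsOf ↥(maximalRealSubfield F) (imagUnitSq F) F (imagUnit F)) (Def411WeilCarriers.Chi ↥(maximalRealSubfield F) F (IsCMField.complexConj F))
    (Def411WeilCarriers.omega ↥(maximalRealSubfield F) F (IsCMField.complexConj F) 3 finProdFinEquiv (Matrix.diagonal (⟨HodgeCM.HermSpace3.Hm V, HodgeCM.HermSpace3.isHermitian V, HodgeCM.HermSpace3.signature_ι₁ V, HodgeCM.HermSpace3.posDef_of_ne V⟩ : HermSpace3 ⟨HodgeCM.CMField.K F⟩ ι₁).diagEntries) (complexConj_imagUnit F) (imagUnit_ne_zero F) (imagUnit_mul_self F) (realDiagonal_isSymm F (⟨HodgeCM.HermSpace3.Hm V, HodgeCM.HermSpace3.isHermitian V, HodgeCM.HermSpace3.signature_ι₁ V, HodgeCM.HermSpace3.posDef_of_ne V⟩ : HermSpace3 ⟨HodgeCM.CMField.K F⟩ ι₁).diagEntries (⟨HodgeCM.HermSpace3.Hm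 V, HodgeCM.HermSpace3.isHermitian V, HodgeCM.HermSpace3.signature_ι₁ V, HodgeCM.HermSpace3.posDef_of_ne V⟩ : HermSpace3 ⟨HodgeCM.CMField.K F⟩ ι₁).complexConj_diagEntries) (isUnit_det_realDiagonal F (⟨HodgeCM.HermSpace3.Hm V, HodgeCM.HermSpace3.isHermitian V, HodgeCM.HermSpace3.signature_ι₁ V, HodgeCM.HermSpace3.posDef_of_ne V⟩ : HermSpace3 ⟨HodgeCM.CMField.K F⟩ ι₁).diagEntries (⟨HodgeCM.HermSpace3.Hm V, HodgeCM.HermSpace3.isHermitian V, HodgeCM.HermSpace3.signature_ι₁ V, HodgeCM.HermSpace3.posDef_of_ne V⟩ : HermSpace3 ⟨HodgeCM.CMField.K F⟩ ι₁).complexConj_diagEntries (⟨HodgeCM.HermSpace3.Hm V, HodgeCM.HermSpace3.isHermitian V, HodgeCM.HermSpace3.signature_ι₁ V, HodgeCM.HermSpace3.posDef_of_ne V⟩ : HermSpace3 ⟨HodgeCM.CMField.K F⟩ ι₁).diagEntries_ne_zero) (realDiagonal_map F (⟨HodgeCM.HermSpace3.Hm V, HodgeCM.HermSpace3.isHermitian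 V, HodgeCM.HermSpace3.signature_ι₁ V, HodgeCM.HermSpace3.posDef_of_ne V⟩ : HermSpace3 ⟨HodgeCM.CMField.K F⟩ ι₁).diagEntries (⟨HodgeCM.HermSpace3.Hm V, HodgeCM.HermSpace3.isHermitian V, HodgeCM.HermSpace3.signature_ι₁ V, HodgeCM.HermSpace3.posDef_of_ne V⟩ : HermSpace3 ⟨HodgeCM.CMField.K F⟩ ι₁).complexConj_diagEntries).symm (OmegaMuSplitting.hsMu ⟨HodgeCM.CMField.K F⟩ ι₁ ⟨HodgeCM.HermSpace3.Hm V, HodgeCM.HermSpace3.isHermitian V, HodgeCM.HermSpace3.signature_ι₁ V, HodgeCM.HermSpace3.posDef_of_ne V⟩ Φ))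
    (Def411WeilCarriers.rho ↥(maximalRealSubfield F) F (IsCMField.complexConj F) 3 finProdFinEquiv (Matrix.diagonal (⟨HodgeCM.HermSpace3.Hm V, HodgeCM.HermSpace3.isHermitian V, HodgeCM.HermSpace3.signature_ι₁ V, HodgeCM.HermSpace3.posDef_of_ne V⟩ : HermSpace3 ⟨HodgeCM.CMField.K F⟩ ι₁).diagEntries) (complexConj_imagUnit F) (imagUnit_ne_zero F) (imagUnit_mul_self F) (realDiagonal_isSymm F (⟨HodgeCM.HermSpace3.Hm V, HodgeCM.HermSpace3.isHermitian V, HodgeCM.HermSpace3.signature_ι₁ V, HodgeCM.HermSpace3.posDef_of_ne V⟩ : HermSpace3 ⟨HodgeCM.CMField.K F⟩ ι₁).diagEntries (⟨HodgeCM.HermSpace3.Hm V, HodgeCM.HermSpace3.isHermitian V, HodgeCM.HermSpace3.signature_ι₁ V, HodgeCM.HermSpace3.posDef_of_ne V⟩ : HermSpace3 ⟨HodgeCM.CMField.K F⟩ ι₁).complexConj_diagEntries) (isUnit_det_realDiagonal F (⟨HodgeCM.HermSpace3.Hm V, HodgeCM.HermSpace3.isHermitian V, HodgeCM.HermSpace3.signature_ι₁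 V, HodgeCM.HermSpace3.posDef_of_ne V⟩ : HermSpace3 ⟨HodgeCM.CMField.K F⟩ ι₁).diagEntries (⟨HodgeCM.HermSpace3.Hm V, HodgeCM.HermSpace3.isHermitian V, HodgeCM.HermSpace3.signature_ι₁ V, HodgeCM.HermSpace3.posDef_of_ne V⟩ : HermSpace3 ⟨HodgeCM.CMField.K F⟩ ι₁).complexConj_diagEntries (⟨HodgeCM.HermSpace3.Hm V, HodgeCM.HermSpace3.isHermitian V, HodgeCM.HermSpace3.signature_ι₁ V, HodgeCM.HermSpace3.posDef_of_ne V⟩ : HermSpace3 ⟨HodgeCM.CMField.K F⟩ ι₁).diagEntries_ne_zero) (realDiagonal_map F (⟨HodgeCM.HermSpace3.Hm V, HodgeCM.HermSpace3.isHermitian V, HodgeCM.HermSpace3.signature_ι₁ V, HodgeCM.HermSpace3.posDef_of_ne V⟩ : HermSpace3 ⟨HodgeCM.CMField.K F⟩ ι₁).diagEntries (⟨HodgeCM.HermSpace3.Hm V, HodgeCM.HermSpace3.isHermitian V, HodgeCM.HermSpace3.signature_ι₁ V, HodgeCM.HermSpace3.posDef_of_ne V⟩ : HermSpace3 ⟨HodgeCM.CMField.K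 F⟩ ι₁).complexConj_diagEntries).symm (OmegaMuSplitting.hsMu ⟨HodgeCM.CMField.K F⟩ ι₁ ⟨HodgeCM.HermSpace3.Hm V, HodgeCM.HermSpace3.isHermitian V, HodgeCM.HermSpace3.signature_ι₁ V, HodgeCM.HermSpace3.posDef_of_ne V⟩ Φ) (⟨HodgeCM.HermSpace3.Hm V, HodgeCM.HermSpace3.isHermitian V, HodgeCM.HermSpace3.signature_ι₁ V, HodgeCM.HermSpace3.posDef_of_ne V⟩ : HermSpace3 ⟨HodgeCM.CMField.K F⟩ ι₁).adelicFinDiag.toMulEquiv.toMonoidHom)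
    ((heckeTranslatesFamilyOf heckeTranslate_definedOver_holds h isoOf ⟨HodgeCM.CMField.K F⟩ ι₁ ⟨HodgeCM.HermSpace3.Hm V, HodgeCM.HermSpace3.isHermitian V, HodgeCM.HermSpace3.signature_ι₁ V, HodgeCM.HermSpace3.posDef_of_ne V⟩ Φ h6).rhoΩOne (AlgHom.id ℚ (HodgeCM.CMField.K F)) ι₁ (isConjugateSymplectic_muOfInvType (F := ⟨HodgeCM.CMField.K F⟩) ι₁ Φ) (hasWeight_one_muOfInvType (F := ⟨HodgeCM.CMField.K F⟩) ι₁ Φ) (Def45.Carriers.ofPolDR (muOfInvType (F := ⟨HodgeCM.CMField.K F⟩) ι₁ Φ) (Def45.PolDR ι₁ (isConjugateSymplectic_muOfInvType (F := ⟨HodgeCM.CMField.K F⟩) ι₁ Φ) (Def45.RMuForm ι₁ (isConjugateSymplectic_muOfInvType (F := ⟨HodgeCM.CMField.K F⟩) ι₁ Φ))))) default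
    (hLiu ⟨HodgeCM.CMField.K F⟩ h6 Φ ι₁ hΦ ⟨HodgeCM.HermSpace3.Hm V, HodgeCM.HermSpace3.isHermitian V, HodgeCM.HermSpace3.signature_ι₁ V, HodgeCM.HermSpace3.posDef_of_ne V⟩)
    (hLiuC F h6 V a₀ Φ hΦ i (muOfInvType (F := ⟨HodgeCM.CMField.K F⟩) ι₁ Φ) (isConjugateSymplectic_muOfInvType (F := ⟨HodgeCM.CMField.K F⟩) ι₁ Φ) (hasWeight_one_muOfInvType (F := ⟨HodgeCM.CMField.K F⟩) ι₁ Φ))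
    (fun a => hirr_of_lemD1AsPrinted_row9 ⟨HodgeCM.CMField.K F⟩ ι₁ ⟨HodgeCM.HermSpace3.Hm V, HodgeCM.HermSpace3.isHermitian V, HodgeCM.HermSpace3.signature_ι₁ V, HodgeCM.HermSpace3.posDef_of_ne V⟩ Φ a.1.1 a.1.2 (OmegaMuSplitting.muLocalSplittings ⟨HodgeCM.CMField.K F⟩ ι₁ ⟨HodgeCM.HermSpace3.Hm V, HodgeCM.HermSpace3.isHermitian V, HodgeCM.HermSpace3.signature_ι₁ V, HodgeCM.HermSpace3.posDef_of_ne V⟩ Φ (lineOf ↥(maximalRealSubfield F) (imagUnitSq F) a.1.1)) (OmegaMuSplitting.hfac_sMu ⟨HodgeCM.CMField.K F⟩ ι₁ ⟨HodgeCM.HermSpace3.Hm V, HodgeCM.HermSpace3.isHermitian V, HodgeCM.HermSpace3.signature_ι₁ V, HodgeCM.HermSpace3.posDef_of_ne V⟩ Φ (lineOf ↥(maximalRealSubfield F) (imagUnitSq F) a.1.1)) (localMu F (OmegaMuSplitting.chiMu ⟨HodgeCM.CMField.K F⟩ ι₁ Φ)) (fun v x => norm_localMu F (OmegaMuSplitting.chiMu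 ⟨HodgeCM.CMField.K F⟩ ι₁ Φ) v (OmegaMuSplitting.chiMu_isUnitary ⟨HodgeCM.CMField.K F⟩ ι₁ Φ) x) (continuous_localMu F (OmegaMuSplitting.chiMu ⟨HodgeCM.CMField.K F⟩ ι₁ Φ)) (fun v t => localMu_toLocalRing_eq_one_iff F (OmegaMuSplitting.chiMu ⟨HodgeCM.CMField.K F⟩ ι₁ Φ) v (OmegaMuSplitting.chiMu_isSplittingChar ⟨HodgeCM.CMField.K F⟩ ι₁ Φ) t) (hD1 ⟨HodgeCM.CMField.K F⟩ h6 Φ ι₁ hΦ ⟨HodgeCM.HermSpace3.Hm V, HodgeCM.HermSpace3.isHermitian V, HodgeCM.HermSpace3.signature_ι₁ V, HodgeCM.HermSpace3.posDef_of_ne V⟩ a.1.1 a.1.2) (Def411WeilCarriers.survival ↥(maximalRealSubfield F) F (IsCMField.complexConj F) 3 finProdFinEquiv (Matrix.diagonal (⟨HodgeCM.HermSpace3.Hm V, HodgeCM.HermSpace3.isHermitian V, HodgeCM.HermSpace3.signature_ι₁ V, HodgeCM.HermSpace3.posDef_of_ne V⟩ : HermSpace3 ⟨HodgeCM.CMField.K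 F⟩ ι₁).diagEntries) (complexConj_imagUnit F) (imagUnit_ne_zero F) (imagUnit_mul_self F) (realDiagonal_isSymm F (⟨HodgeCM.HermSpace3.Hm V, HodgeCM.HermSpace3.isHermitian V, HodgeCM.HermSpace3.signature_ι₁ V, HodgeCM.HermSpace3.posDef_of_ne V⟩ : HermSpace3 ⟨HodgeCM.CMField.K F⟩ ι₁).diagEntries (⟨HodgeCM.HermSpace3.Hm V, HodgeCM.HermSpace3.isHermitian V, HodgeCM.HermSpace3.signature_ι₁ V, HodgeCM.HermSpace3.posDef_of_ne V⟩ : HermSpace3 ⟨HodgeCM.CMField.K F⟩ ι₁).complexConj_diagEntries) (isUnit_det_realDiagonal F (⟨HodgeCM.HermSpace3.Hm V, HodgeCM.HermSpace3.isHermitian V, HodgeCM.HermSpace3.signature_ι₁ V, HodgeCM.HermSpace3.posDef_of_ne V⟩ : HermSpace3 ⟨HodgeCM.CMField.K F⟩ ι₁).diagEntries (⟨HodgeCM.HermSpace3.Hm V, HodgeCM.HermSpace3.isHermitian V, HodgeCM.HermSpace3.signature_ι₁ V, HodgeCM.HermSpace3.posDef_of_ne V⟩ : HermSpace3 ⟨HodgeCM.CMField.K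 F⟩ ι₁).complexConj_diagEntries (⟨HodgeCM.HermSpace3.Hm V, HodgeCM.HermSpace3.isHermitian V, HodgeCM.HermSpace3.signature_ι₁ V, HodgeCM.HermSpace3.posDef_of_ne V⟩ : HermSpace3 ⟨HodgeCM.CMField.K F⟩ ι₁).diagEntries_ne_zero) (realDiagonal_map F (⟨HodgeCM.HermSpace3.Hm V, HodgeCM.HermSpace3.isHermitian V, HodgeCM.HermSpace3.signature_ι₁ V, HodgeCM.HermSpace3.posDef_of_ne V⟩ : HermSpace3 ⟨HodgeCM.CMField.K F⟩ ι₁).diagEntries (⟨HodgeCM.HermSpace3.Hm V, HodgeCM.HermSpace3.isHermitian V, HodgeCM.HermSpace3.signature_ι₁ V, HodgeCM.HermSpace3.posDef_of_ne V⟩ : HermSpace3 ⟨HodgeCM.CMField.K F⟩ ι₁).complexConj_diagEntries).symm a.1.1 a.1.2 (OmegaMuSplitting.muLocalSplittings ⟨HodgeCM.CMField.K F⟩ ι₁ ⟨HodgeCM.HermSpace3.Hm V, HodgeCM.HermSpace3.isHermitian V, HodgeCM.HermSpace3.signature_ι₁ V, HodgeCM.HermSpace3.posDef_of_ne V⟩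 Φ (lineOf ↥(maximalRealSubfield F) (imagUnitSq F) a.1.1))))
    (fun b hb => isIrreducible_rhoAt_muConj_rest_of_def411AsPrinted (uniformOmegaRep h ⟨HodgeCM.CMField.K F⟩ ι₁ ⟨HodgeCM.HermSpace3.Hm V, HodgeCM.HermSpace3.isHermitian V, HodgeCM.HermSpace3.signature_ι₁ V, HodgeCM.HermSpace3.posDef_of_ne V⟩ Φ e₁ (frameD V) (frameD_real V) (frameD_ne V) (ιVE V) (2 * imagUnit (HodgeCM.CMField.K F))⁻¹ (fun _ _ => (Rep.update ↥(maximalRealSubfield (HodgeCM.CMField.K F)) (imagUnitSq (HodgeCM.CMField.K F)) (Rep.ofLineOf ↥(maximalRealSubfield (HodgeCM.CMField.K F)) (imagUnitSq (HodgeCM.CMField.K F))) (locF ↥(maximalRealSubfield (HodgeCM.CMField.K F)) (imagUnitSq (HodgeCM.CMField.K F)) (realUnit ⟨HodgeCM.CMField.K F⟩ (repAt a₀ (Sigma.fst i)).1 (repAt a₀ (Sigma.fst i)).2.1 (repAt a₀ (Sigma.fst i)).2.2)) (realUnit ⟨HodgeCM.CMField.K F⟩ (repAt a₀ (Sigma.fst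 i)).1 (repAt a₀ (Sigma.fst i)).2.1 (repAt a₀ (Sigma.fst i)).2.2) rfl)))
      (restTailOne (AlgHom.id ℚ (HodgeCM.CMField.K F)) ι₁ (isConjugateSymplectic_muOfInvType (F := ⟨HodgeCM.CMField.K F⟩) ι₁ Φ) (hasWeight_one_muOfInvType (F := ⟨HodgeCM.CMField.K F⟩) ι₁ Φ) (Def45.Carriers.ofPolDR (muOfInvType (F := ⟨HodgeCM.CMField.K F⟩) ι₁ Φ) (Def45.PolDR ι₁ (isConjugateSymplectic_muOfInvType (F := ⟨HodgeCM.CMField.K F⟩) ι₁ Φ) (Def45.RMuForm ι₁ (isConjugateSymplectic_muOfInvType (F := ⟨HodgeCM.CMField.K F⟩) ι₁ Φ)))) ((heckeTranslatesFamilyOf heckeTranslate_definedOver_holds h isoOf ⟨HodgeCM.CMField.K F⟩ ι₁ ⟨HodgeCM.HermSpace3.Hm V, HodgeCM.HermSpace3.isHermitian V, HodgeCM.HermSpace3.signature_ι₁ V, HodgeCM.HermSpace3.posDef_of_ne V⟩ Φ h6).rhoΩOne (AlgHom.id ℚ (HodgeCM.CMField.K F)) ι₁ (isConjugateSymplectic_muOfInvType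 (F := ⟨HodgeCM.CMField.K F⟩) ι₁ Φ) (hasWeight_one_muOfInvType (F := ⟨HodgeCM.CMField.K F⟩) ι₁ Φ) (Def45.Carriers.ofPolDR (muOfInvType (F := ⟨HodgeCM.CMField.K F⟩) ι₁ Φ) (Def45.PolDR ι₁ (isConjugateSymplectic_muOfInvType (F := ⟨HodgeCM.CMField.K F⟩) ι₁ Φ) (Def45.RMuForm ι₁ (isConjugateSymplectic_muOfInvType (F := ⟨HodgeCM.CMField.K F⟩) ι₁ Φ))))))
      (restTailOne (AlgHom.id ℚ (HodgeCM.CMField.K F)) ι₁ (isConjugateSymplectic_muOfInvType (F := ⟨HodgeCM.CMField.K F⟩) ι₁ Φ).galConj (hasWeight_one_muOfInvType (F := ⟨HodgeCM.CMField.K F⟩) ι₁ Φ).galConj_complexConj (Def45.Carriers.ofPolDR (Literature.NumberTheory.Automorphic.IdeleClassGroup.galConj (IsCMField.complexConj (HodgeCM.CMField.K F)) (muOfInvType (F := ⟨HodgeCM.CMField.K F⟩) ι₁ Φ)) (Def45.PolDR ι₁ (isConjugateSymplectic_muOfInvType (F := ⟨HodgeCM.CMField.K F⟩) ι₁ Φ).galConj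 (Def45.RMuForm ι₁ (isConjugateSymplectic_muOfInvType (F := ⟨HodgeCM.CMField.K F⟩) ι₁ Φ).galConj))) ((heckeTranslatesFamilyOf heckeTranslate_definedOver_holds h isoOf ⟨HodgeCM.CMField.K F⟩ ι₁ ⟨HodgeCM.HermSpace3.Hm V, HodgeCM.HermSpace3.isHermitian V, HodgeCM.HermSpace3.signature_ι₁ V, HodgeCM.HermSpace3.posDef_of_ne V⟩ Φ h6).rhoΩOne (AlgHom.id ℚ (HodgeCM.CMField.K F)) ι₁ (isConjugateSymplectic_muOfInvType (F := ⟨HodgeCM.CMField.K F⟩) ι₁ Φ).galConj (hasWeight_one_muOfInvType (F := ⟨HodgeCM.CMField.K F⟩) ι₁ Φ).galConj_complexConj (Def45.Carriers.ofPolDR (Literature.NumberTheory.Automorphic.IdeleClassGroup.galConj (IsCMField.complexConj (HodgeCM.CMField.K F)) (muOfInvType (F := ⟨HodgeCM.CMField.K F⟩) ι₁ Φ)) (Def45.PolDR ι₁ (isConjugateSymplectic_muOfInvType (F := ⟨HodgeCM.CMField.K F⟩) ι₁ Φ).galConj (Def45.RMuForm ι₁ (isConjugateSymplectic_muOfInvType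 (F := ⟨HodgeCM.CMField.K F⟩) ι₁ Φ).galConj))))) h411U b hb)
  exact key

end Summit.HodgeConjecture.CorCM.D2Bridge.SeamA

end
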